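import Literature.MathematicalPhysics.QuantumFieldTheory.BalabanImbrieJaffe1984to88.BIJ88SmoothFactors5133
import Literature.MathematicalPhysics.QuantumFieldTheory.BalabanImbrieJaffe1984to88.BIJ88SlotMomentsGauss308
import Mathlib.Analysis.InnerProductSpace.Calculus

/-!
# `BalabanImbrieJaffe1984to88.BIJ88SlotFactorsSmooth308` — T. Bałaban, J. Imbrie, A. Jaffe, *Effective action and cluster properties of
the abelian Higgs model*, Commun. Math. Phys. **114** (1988) 257–315 [BalabanImbrieJaffe1988]: pp. 304–309 [PDF 48–53] (Sects. 5.13,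
5.14) — **THE LOCATED SLOT FACTORS OF THE DECOUPLING EXPANSION ARE SMOOTH FACTORS OF THE FIELD**.  Print treats every cube of a polymer by
integration by parts in the field (p. 305: *"We integrate by parts all fields appearing in this formula. Each Φ contracts through a C_s to
another Φ, to an f(□_i)_s or to ℱ."*; p. 304: *"f(□_i) is the product of all the factors under the dμ … integral above that are localized
in □_i"*), and in Sect. 5.14 the factors are the t-differentiated slots of p. 308 (*"We express each d/dt as a sum Σ_γ (d/dt)_γ where
(d/dt)_γ acts only on the t before a particular term V^{(k)}(Y) in Ṽ^{(k)} or in a particular χ-factor"*), whose χ-factors are the cutoffs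
of (5.2.3)–(5.2.4) (*"We let χ(1,x) be an even, C^∞ function, equal to zero for |x| ≥ 1, and equal to one for |x| ≤ 9/10"*) at the
interpolated scale `c·p(te_k)` (p. 309: *"Each t-derivative of a χ-factor in χ_{Λ₁₂^{(k)},t} gives at least a factor … and similarly the
n-th derivative in t of χ(cp(e_k), A^{(k)}) is bounded by t^{−n} times a function bounded by a constant and supported in
c₁p(te_k) ≤ |A^{(k)}| ≤ c₂p(te_k)"*).  For the integration by parts to act on these factors they must lie in the class of smooth factors of
the §5.13 walk form — in the tree, p13's `BIJ88SmoothFactors5133.CbInf` (`C^∞` in the field with every derivative bounded; the class of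
`BIJ88WalkFormIntegrated5133`).  THIS FILE PROVES THAT MEMBERSHIP for the located slot data of the lineage (p25's derivative observables
`BIJ88Expansion5143Gauss.fD` on p36's slot factors `BIJ88SlotMomentsGauss308.uD` = `∂_t^m χ(c_b p(te_k), Φ_b(φ))`, `(−V_Y(φ))^m e^{−tV_Y(φ)}`).

statement-level skeleton of published theorems with citation tags; proofs where landed; nothing here is a claim about the Yang–Mills mass gap

PDF held: `paper:balaban1988-cmp114-bij-abelian-higgs-effective-action` (journal page = PDF page + 256); pages re-read this session as text:
PDF 48 (p. 304) L30–31, PDF 49 (p. 305) L40–43, PDF 52 (p. 308) L28–29, PDF 53 (p. 309) L21–28.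

CITATION HEADER (lean-in-tree rule).  Part of the lit-balaban TYPED SKELETON (HOME `run/shared/lean/pub/lit-balaban/`), Phase 2, seat p36
(gen 20, unit `lit-balaban-p36`); rows **C2.Eq5.14.3-5.14.4** (member: the typing precondition of print's route for the χ-slots in EVERY cube of
the located (5.14.4), SUCCESSOR-g21 §f / owner r16 value item (3)) and C2.Eq5.13.3-5.13.4 (the class `CbInf` of p13's walk form) of
`HOME/lit-balaban-r16/ROWS-C2-part2.md`.  WHAT IS REPRODUCED (theorem-only; no definitions, no `Prop` facts; axioms standard):
* §1 closure of `C_b^∞` the walk form needs for the `V(Y)`-slots: `cbInf_comp_smooth` (post-composition with a smooth `g : ℝ → ℝ` whose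
  derivatives are bounded on the member's range — Faà di Bruno, Mathlib's `norm_iteratedFDeriv_comp_le`), `cbInf_exp`, `cbInf_pow`, `cbInf_neg`,
  `cbInf_const_mul`;
* §2 the χ-factor as a function of ITS ARGUMENT after `m` t-derivatives: **`iteratedDeriv_chi1_mul_repr`** — the STRUCTURE THEOREM
  `∂_s^m χ(1, u·ρ(s)) = Σ_{j ≤ m} a_j(s)·u^j·χ^{(j)}(1, u·ρ(s))` with coefficient functions smooth on the open set where the scale `ρ` is and
  INDEPENDENT of `u` (the iterated chain rule behind print's *"similarly the n-th derivative"*); hence `contDiff_iteratedDeriv_chi1_mul` (smooth in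
  `u`), `iteratedDeriv_chi1_mul_eq_zero` (vanishes for `|u·ρ(t)| > 1` — print's support clause, upper end), `iteratedDeriv_chi1_mul_eventuallyEq_zero`
  (constant for `u` near `0`: χ(1,·) = 1 on `|x| ≤ 9/10`), **`cbInf_iteratedDeriv_chi1_mul`** (`u ↦ ∂_s^m χ(1,u·ρ(s))|_{s=t} ∈ C_b^∞(ℝ)`) and the
  MODULUS version **`cbInf_iteratedDeriv_chi1_norm_mul`** (`v ↦ ∂_s^m χ(1,‖v‖·ρ(s))|_{s=t} ∈ C_b^∞(F)`, `F` Euclidean — smooth across `v = 0`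
  because the factor is flat there, `contDiff_comp_norm`);
* §3 ON THE CELL'S OBJECTS (`cutoff`, `pLog`, the branch `0 < t`, `te_k < 1` of `BIJ88ChiTDerivN309`, scale `ρ(s) = (c·p(se_k))⁻¹` smooth there:
  `contDiffAt_inv_scale`, `inv_scale_ne_zero`): **`cbInf_iteratedDeriv_cutoff_linear`** / `…_abs_linear` / **`…_norm_linear`** — `φ ↦ ∂_t^m
χ(c·p(te_k), Φ(φ))`
  is in `C_b^∞` for a slot field `Φ = ℓ` linear, `|ℓ|`, or `‖L(·)‖` (modulus of a vector-valued linear field, e.g. a complex component), `c ≠ 0`;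
  `cbInf_iteratedDeriv_expWeight` — `φ ↦ ∂_t^m e^{−tV(φ)} ∈ C_b^∞` for `V ∈ C_b^∞`; `cbInf_uD_inl`, `cbInf_uD_inr`, and the assembly
  **`cbInf_fD_uD`: every cube's located derivative observable `Π_{τ : cube τ = i} ∂_t^{#slots at τ}(factor τ)` is in `C_b^∞`** (linear slot fields,
  `c_b ≠ 0`, `V_Y ∈ C_b^∞`, `t` on the branch).
HONEST SCOPE.  Calculus only: no expectation, no estimate, no power of `e_k` is produced here (the Gaussian shell estimate for ONE φ-derivative of a
χ-factor is `BIJ88ChiFieldDeriv307`; the t-derivative bounds are `BIJ88ChiTDeriv309`/`BIJ88ChiTDerivN309`).  The hypothesis `V_Y ∈ C_b^∞` is a TYPING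
the walk form imposes, not print's letter: print's `V^{(k)}(Y)` is *"a small polynomial in A^{(k)}, φ^{(k)}"* (p. 309), bounded only on the support
of the χ-factors; the lineage's §5.13 model so far carries `V_Y` as a bounded measurable letter `|V_Y| ≤ K_Y`.  Slot fields: print's `Φ_b` are the
linear forms `(1 − Q_s*Q)A^{(k)}(b)`, `φ^{(k)}(x)` of the integration variables through their moduli — the cases covered.  NOT here: the walk form
(5.13.3) applied to these factors, the per-cube small factors of (5.14.4), (5.14.4) itself.
-/

namespace Literature.MathematicalPhysics.QuantumFieldTheory.BalabanImbrieJaffe1984to88.BIJ88SlotFactorsSmooth308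

open Finset Filter Topology
open scoped BigOperators ContDiff
open BIJ88SmoothFactors5133 (CbInf)

/-! ## §1 Closure of `C_b^∞` under post-composition, exponentials, powers -/

section Cb

variable {E : Type} [NormedAddCommGroup E] [NormedSpace ℝ E]

/-- post-composition with a smooth `g : ℝ → ℝ` all of whose derivatives are bounded on the range of the member (Faà di Bruno bound).
[cite: BalabanImbrieJaffe1988, §5.13 p.305] -/
theorem cbInf_comp_smooth {G : E → ℝ} (hG : CbInf G) {g : ℝ → ℝ} (hg : ContDiff ℝ ∞ g)
    (hb : ∀ n : ℕ, ∃ C : ℝ, ∀ φ, ‖iteratedFDeriv ℝ n g (G φ)‖ ≤ C) : CbInf (fun φ => g (G φ)) := by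
  refine ⟨hg.comp hG.1, fun n => ?_⟩
  obtain ⟨K, hK0, hK⟩ := hG.bound_le n
  choose C hC using hb
  refine ⟨(n.factorial : ℝ) * (∑ i ∈ range (n + 1), |C i|) * (max 1 K) ^ n, fun φ => ?_⟩
  have hCi : ∀ i, i ≤ n → ‖iteratedFDeriv ℝ i g (G φ)‖ ≤ ∑ k ∈ range (n + 1), |C k| := fun i hi =>
    ((hC i φ).trans (le_abs_self _)).trans
      (single_le_sum (f := fun k => |C k|) (fun _ _ => abs_nonneg _) (mem_range.2 (Nat.lt_succ_of_le hi)))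
  have hDi : ∀ i, 1 ≤ i → i ≤ n → ‖iteratedFDeriv ℝ i G φ‖ ≤ (max 1 K) ^ i := fun i h1 hi =>
    ((hK i hi φ).trans (le_max_right 1 K)).trans (le_self_pow₀ (le_max_left 1 K) (by omega))
  exact norm_iteratedFDeriv_comp_le (g := g) (f := G) hg hG.1 (mod_cast le_top) φ hCi hDi

/-- exponentials of members are members (the member is bounded, so every derivative of `exp` is bounded on its range).
[cite: BalabanImbrieJaffe1988, §5.13 p.305] -/
theorem cbInf_exp {G : E → ℝ} (hG : CbInf G) : CbInf (fun φ => Real.exp (G φ)) := by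
  obtain ⟨K₀, hK₀⟩ := hG.bdd
  refine cbInf_comp_smooth hG Real.contDiff_exp fun n => ⟨Real.exp K₀, fun φ => ?_⟩
  rw [norm_iteratedFDeriv_eq_norm_iteratedDeriv, iteratedDeriv_eq_iterate, Real.iter_deriv_exp, Real.norm_eq_abs,
    Real.abs_exp]
  exact Real.exp_le_exp.2 (le_of_abs_le (hK₀ φ))

/-- powers of members are members. [cite: BalabanImbrieJaffe1988, §5.13 p.305] -/
theorem cbInf_pow {G : E → ℝ} (hG : CbInf G) (m : ℕ) : CbInf (fun φ => G φ ^ m) := by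
  induction m with
  | zero => simpa using BIJ88SmoothFactors5133.CbInf.const (E := E) 1
  | succ m ih => simpa [pow_succ] using ih.mul hG

/-- negatives of members are members. [cite: BalabanImbrieJaffe1988, §5.13 p.305] -/
theorem cbInf_neg {G : E → ℝ} (hG : CbInf G) : CbInf (fun φ => -G φ) := by
  simpa using (BIJ88SmoothFactors5133.CbInf.const (E := E) (-1)).mul hG

/-- scalar multiples of members are members. [cite: BalabanImbrieJaffe1988, §5.13 p.305] -/
theorem cbInf_const_mul {G : E → ℝ} (hG : CbInf G) (a : ℝ) : CbInf (fun φ => a * G φ) :=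
  (BIJ88SmoothFactors5133.CbInf.const (E := E) a).mul hG

end Cb


/-! ## §2 The s-derivatives of `s ↦ χ(1, u·ρ(s))`: structure, smoothness and support in `u` -/

section Chi

variable (χ : BIJ88Sect5Statements.CutoffProfile)

/-- every derivative of χ(1,·) is smooth. [cite: BalabanImbrieJaffe1988, (5.2.3) p.278, (5.14.3) p.309] -/
theorem contDiff_iteratedDeriv_chi1 (j : ℕ) : ContDiff ℝ ∞ (iteratedDeriv j χ.χ₁) := by
  rw [iteratedDeriv_eq_iterate]; exact χ.smooth.iterate_deriv j

/-- the derivative of the `j`-th derivative of χ(1,·) is the `(j+1)`-st. [cite: BalabanImbrieJaffe1988, (5.2.3) p.278, (5.14.3) p.309] -/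
theorem hasDerivAt_iteratedDeriv_chi1 (j : ℕ) (x : ℝ) :
    HasDerivAt (iteratedDeriv j χ.χ₁) (iteratedDeriv (j + 1) χ.χ₁ x) x := by
  rw [iteratedDeriv_succ]
  exact ((contDiff_iteratedDeriv_chi1 χ j).differentiable (by simp)).differentiableAt.hasDerivAt

variable {ρ : ℝ → ℝ} {U : Set ℝ}

/-- **STRUCTURE of the s-derivatives of `s ↦ χ(1, u·ρ(s))`** (`ρ` smooth on an open set `U`): for every order `m` there are coefficient
functions `a_j`, smooth on `U` and INDEPENDENT OF `u`, with `∂_s^m χ(1, u·ρ(s)) = Σ_{j ≤ m} a_j(s)·u^j·χ^{(j)}(1, u·ρ(s))` on `U`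
(the chain rule iterated: each `∂_s` either hits a coefficient or raises `j` by one, producing `u·ρ′(s)`).
 [cite: BalabanImbrieJaffe1988, (5.2.3) p.278, (5.14.3) p.309] -/
theorem iteratedDeriv_chi1_mul_repr (hU : IsOpen U) (hρ : ∀ s ∈ U, ContDiffAt ℝ ∞ ρ s) (m : ℕ) :
    ∃ a : ℕ → ℝ → ℝ, (∀ j, ∀ s ∈ U, ContDiffAt ℝ ∞ (a j) s) ∧
      ∀ s ∈ U, ∀ u : ℝ, iteratedDeriv m (fun σ => χ.χ₁ (u * ρ σ)) s =
        ∑ j ∈ range (m + 1), a j s * (u ^ j * iteratedDeriv j χ.χ₁ (u * ρ s)) := by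
  induction m with
  | zero =>
    refine ⟨fun j _ => if j = 0 then 1 else 0, fun j s _ => contDiffAt_const, fun s _ u => ?_⟩
    simp
  | succ m ih =>
    obtain ⟨a, ha, hrep⟩ := ih
    refine ⟨fun j s => (if j ≤ m then deriv (a j) s else 0) + (if j = 0 then 0 else a (j - 1) s * deriv ρ s),
      fun j s hs => ?_, fun s hs u => ?_⟩
    · refine ContDiffAt.add ?_ ?_
      · split_ifs
        · exact (ha j s hs).derivWithin le_rfl
        · exact contDiffAt_const
      · split_ifs
        · exact contDiffAt_const
        · exact (ha (j - 1) s hs).mul ((hρ s hs).derivWithin le_rfl)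
    · rw [iteratedDeriv_succ]
      have hev : iteratedDeriv m (fun σ => χ.χ₁ (u * ρ σ)) =ᶠ[𝓝 s]
          fun σ => ∑ j ∈ range (m + 1), a j σ * (u ^ j * iteratedDeriv j χ.χ₁ (u * ρ σ)) := by
        filter_upwards [hU.mem_nhds hs] with σ hσ using hrep σ hσ u
      rw [hev.deriv_eq]
      have hd : HasDerivAt (fun σ => ∑ j ∈ range (m + 1), a j σ * (u ^ j * iteratedDeriv j χ.χ₁ (u * ρ σ)))
          (∑ j ∈ range (m + 1), (deriv (a j) s * (u ^ j * iteratedDeriv j χ.χ₁ (u * ρ s)) +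
            a j s * (u ^ j * (iteratedDeriv (j + 1) χ.χ₁ (u * ρ s) * (u * deriv ρ s))))) s := by
        refine HasDerivAt.fun_sum fun j _ => ?_
        have h1 : HasDerivAt (a j) (deriv (a j) s) s := ((ha j s hs).differentiableAt (by simp)).hasDerivAt
        have h2 : HasDerivAt (fun σ => u * ρ σ) (u * deriv ρ s) s :=
          (((hρ s hs).differentiableAt (by simp)).hasDerivAt).const_mul u
        have h3 : HasDerivAt (fun σ => iteratedDeriv j χ.χ₁ (u * ρ σ))
            (iteratedDeriv (j + 1) χ.χ₁ (u * ρ s) * (u * deriv ρ s)) s := by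
          have h := (hasDerivAt_iteratedDeriv_chi1 χ j (u * ρ s)).comp s h2
          exact h
        exact h1.mul (h3.const_mul (u ^ j))
      rw [hd.deriv]
      have hX : ∀ j ∈ range (m + 1), (if j ≤ m then deriv (a j) s else 0) = deriv (a j) s := fun j hj => by
        rw [if_pos (Nat.lt_succ_iff.mp (mem_range.mp hj))]
      symm
      calc ∑ j ∈ range (m + 1 + 1), ((if j ≤ m then deriv (a j) s else 0) +
              (if j = 0 then 0 else a (j - 1) s * deriv ρ s)) * (u ^ j * iteratedDeriv j χ.χ₁ (u * ρ s))
          = ∑ j ∈ range (m + 1 + 1), (if j ≤ m then deriv (a j) s else 0) * (u ^ j * iteratedDeriv j χ.χ₁ (u * ρ s)) +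
              ∑ j ∈ range (m + 1 + 1), (if j = 0 then 0 else a (j - 1) s * deriv ρ s) *
                (u ^ j * iteratedDeriv j χ.χ₁ (u * ρ s)) := by
            rw [← sum_add_distrib]; exact sum_congr rfl fun j _ => add_mul _ _ _
        _ = ∑ j ∈ range (m + 1), deriv (a j) s * (u ^ j * iteratedDeriv j χ.χ₁ (u * ρ s)) +
              ∑ j ∈ range (m + 1), a j s * deriv ρ s * (u ^ (j + 1) * iteratedDeriv (j + 1) χ.χ₁ (u * ρ s)) := by
            congr 1
            · rw [sum_range_succ, if_neg (by omega), zero_mul, add_zero]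
              exact sum_congr rfl fun j hj => by rw [hX j hj]
            · rw [sum_range_succ']
              simp
        _ = ∑ j ∈ range (m + 1), (deriv (a j) s * (u ^ j * iteratedDeriv j χ.χ₁ (u * ρ s)) +
              a j s * (u ^ j * (iteratedDeriv (j + 1) χ.χ₁ (u * ρ s) * (u * deriv ρ s)))) := by
            rw [← sum_add_distrib]; exact sum_congr rfl fun j _ => by ring

/-- **smoothness in `u`**: at a point `t ∈ U`, `u ↦ ∂_s^m χ(1, u·ρ(s))|_{s=t}` is `C^∞` (by the structure theorem: a finite sum of
monomials times derivatives of χ(1,·) at `u·ρ(t)`). [cite: BalabanImbrieJaffe1988, (5.2.3) p.278, (5.14.3) p.309] -/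
theorem contDiff_iteratedDeriv_chi1_mul (hU : IsOpen U) (hρ : ∀ s ∈ U, ContDiffAt ℝ ∞ ρ s) (m : ℕ) {t : ℝ} (ht : t ∈ U) :
    ContDiff ℝ ∞ fun u : ℝ => iteratedDeriv m (fun σ => χ.χ₁ (u * ρ σ)) t := by
  obtain ⟨a, -, hrep⟩ := iteratedDeriv_chi1_mul_repr χ hU hρ m
  rw [show (fun u : ℝ => iteratedDeriv m (fun σ => χ.χ₁ (u * ρ σ)) t) =
      fun u => ∑ j ∈ range (m + 1), a j t * (u ^ j * iteratedDeriv j χ.χ₁ (u * ρ t)) from funext fun u => hrep t ht u]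
  exact ContDiff.sum fun j _ => contDiff_const.mul ((contDiff_id.pow j).mul
    ((contDiff_iteratedDeriv_chi1 χ j).comp (contDiff_id.mul contDiff_const)))

/-- **support in `u`**: where `|u·ρ(t)| > 1` the factor `s ↦ χ(1, u·ρ(s))` vanishes near `t` (`ρ` continuous at `t`), so all its
s-derivatives vanish at `t`. [cite: BalabanImbrieJaffe1988, (5.2.3) p.278, (5.14.3) p.309] -/
theorem iteratedDeriv_chi1_mul_eq_zero (m : ℕ) {t : ℝ} (hρ : ContinuousAt ρ t) {u : ℝ} (hu : 1 < |u * ρ t|) :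
    iteratedDeriv m (fun σ => χ.χ₁ (u * ρ σ)) t = 0 := by
  have hev : (fun σ => χ.χ₁ (u * ρ σ)) =ᶠ[𝓝 t] fun _ => (0 : ℝ) := by
    filter_upwards [(continuous_abs.continuousAt.comp (hρ.const_mul u)).eventually_const_lt hu] with σ hσ
    exact χ.eq_zero _ hσ.le
  rw [hev.iteratedDeriv_eq, iteratedDeriv_const]
  simp

/-- **`u ↦ ∂_s^m χ(1, u·ρ(s))|_{s=t}` is in `C_b^∞(ℝ)`** for `t ∈ U`, `ρ(t) ≠ 0`: smooth of compact support `|u| ≤ 1/|ρ(t)|`.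
[cite: BalabanImbrieJaffe1988, (5.2.3) p.278, (5.14.3) p.309] -/
theorem cbInf_iteratedDeriv_chi1_mul (hU : IsOpen U) (hρ : ∀ s ∈ U, ContDiffAt ℝ ∞ ρ s) (m : ℕ) {t : ℝ} (ht : t ∈ U)
    (hρt : ρ t ≠ 0) : CbInf fun u : ℝ => iteratedDeriv m (fun σ => χ.χ₁ (u * ρ σ)) t := by
  refine BIJ88SmoothFactors5133.CbInf.of_hasCompactSupport (contDiff_iteratedDeriv_chi1_mul χ hU hρ m ht) ?_
  refine HasCompactSupport.intro (isCompact_closedBall (0 : ℝ) (1 / |ρ t|)) fun u hu => ?_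
  refine iteratedDeriv_chi1_mul_eq_zero χ m (hρ t ht).continuousAt ?_
  rw [Metric.mem_closedBall, dist_zero_right, Real.norm_eq_abs, not_le] at hu
  rw [abs_mul]
  have hρ0 : 0 < |ρ t| := abs_pos.2 hρt
  calc (1 : ℝ) = 1 / |ρ t| * |ρ t| := by field_simp
    _ < |u| * |ρ t| := mul_lt_mul_of_pos_right hu hρ0

/-- **flat near `u = 0`**: since χ(1,·) = 1 on `|x| ≤ 9/10` and `ρ` is continuous at `t`, for `u` near `0` the factor `s ↦ χ(1, u·ρ(s))`
is identically `1` near `t`, so `u ↦ ∂_s^m χ(1, u·ρ(s))|_{s=t}` is constant near `u = 0` (*"equal to one for |x| ≤ 9/10"*).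
[cite: BalabanImbrieJaffe1988, (5.2.3) p.278, (5.14.3) p.309] -/
theorem iteratedDeriv_chi1_mul_eventuallyEq_zero (m : ℕ) {t : ℝ} (hρ : ContinuousAt ρ t) :
    ∀ᶠ u in 𝓝 (0 : ℝ), iteratedDeriv m (fun σ => χ.χ₁ (u * ρ σ)) t = iteratedDeriv m (fun σ => χ.χ₁ (0 * ρ σ)) t := by
  have hN : ∀ᶠ σ in 𝓝 t, |ρ σ| < |ρ t| + 1 := (continuous_abs.continuousAt.comp hρ).eventually_lt_const (lt_add_one _)
  have hR : (0 : ℝ) < |ρ t| + 1 := by positivity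
  have hδ : (0 : ℝ) < 9 / 10 / (|ρ t| + 1) := by positivity
  filter_upwards [Metric.ball_mem_nhds (0 : ℝ) hδ] with u hu
  rw [mem_ball_zero_iff, Real.norm_eq_abs] at hu
  have hev : (fun σ => χ.χ₁ (u * ρ σ)) =ᶠ[𝓝 t] fun σ => χ.χ₁ (0 * ρ σ) := by
    filter_upwards [hN] with σ hσ
    rw [zero_mul, χ.eq_one 0 (by norm_num), χ.eq_one]
    rw [abs_mul]
    calc |u| * |ρ σ| ≤ 9 / 10 / (|ρ t| + 1) * (|ρ t| + 1) := mul_le_mul hu.le hσ.le (abs_nonneg _) hδ.le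
      _ = 9 / 10 := by field_simp
  exact hev.iteratedDeriv_eq m

variable {F : Type} [NormedAddCommGroup F] [InnerProductSpace ℝ F] in
/-- a smooth `g : ℝ → ℝ` constant near `0`, composed with a Euclidean norm, is smooth (off the origin the norm is smooth; at the origin the
composite is locally constant). [cite: BalabanImbrieJaffe1988, (5.2.3) p.278, (5.14.3) p.309] -/
theorem contDiff_comp_norm {g : ℝ → ℝ} (hg : ContDiff ℝ ∞ g) (h0 : ∀ᶠ u in 𝓝 (0 : ℝ), g u = g 0) :
    ContDiff ℝ ∞ fun v : F => g ‖v‖ := by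
  refine contDiff_iff_contDiffAt.2 fun v => ?_
  by_cases hv : v = 0
  · subst hv
    have hT : Tendsto (fun v : F => ‖v‖) (𝓝 0) (𝓝 0) := by simpa using (continuous_norm (E := F)).tendsto 0
    exact contDiffAt_const.congr_of_eventuallyEq (hT.eventually h0)
  · exact hg.contDiffAt.comp v (contDiffAt_norm ℝ hv)

variable {F : Type} [NormedAddCommGroup F] [InnerProductSpace ℝ F] [FiniteDimensional ℝ F] in
/-- **modulus version**: `v ↦ ∂_s^m χ(1, ‖v‖·ρ(s))|_{s=t}` is in `C_b^∞(F)` for a finite-dimensional Euclidean `F` (`t ∈ U`, `ρ(t) ≠ 0`) —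
the χ-factors of p. 308 restrict MODULI of (complex) fields. [cite: BalabanImbrieJaffe1988, (5.2.3) p.278, (5.14.3) p.309] -/
theorem cbInf_iteratedDeriv_chi1_norm_mul (hU : IsOpen U) (hρ : ∀ s ∈ U, ContDiffAt ℝ ∞ ρ s) (m : ℕ) {t : ℝ} (ht : t ∈ U)
    (hρt : ρ t ≠ 0) : CbInf fun v : F => iteratedDeriv m (fun σ => χ.χ₁ (‖v‖ * ρ σ)) t := by
  refine BIJ88SmoothFactors5133.CbInf.of_hasCompactSupport
    (contDiff_comp_norm (g := fun u => iteratedDeriv m (fun σ => χ.χ₁ (u * ρ σ)) t)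
      (contDiff_iteratedDeriv_chi1_mul χ hU hρ m ht) (iteratedDeriv_chi1_mul_eventuallyEq_zero χ m (hρ t ht).continuousAt)) ?_
  refine HasCompactSupport.intro (isCompact_closedBall (0 : F) (1 / |ρ t|)) fun v hv => ?_
  refine iteratedDeriv_chi1_mul_eq_zero χ m (hρ t ht).continuousAt ?_
  rw [Metric.mem_closedBall, dist_zero_right, not_le] at hv
  rw [abs_mul, abs_norm]
  have hρ0 : 0 < |ρ t| := abs_pos.2 hρt
  calc (1 : ℝ) = 1 / |ρ t| * |ρ t| := by field_simp
    _ < ‖v‖ * |ρ t| := mul_lt_mul_of_pos_right hv hρ0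

end Chi


/-! ## §3 The p. 308 slot factors seen as functions of the field: χ-slots (linear slot fields) and `V(Y)`-slots -/

section Slots

open BIJ88Sect2Statements (pLog)
open BIJ88Sect5Statements (CutoffProfile cutoff)

variable (χ : CutoffProfile) {α : Type} [Fintype α]

/-- the scale function `s ↦ (c·p(se_k))⁻¹` is smooth at every point of the open branch `0 < s`, `se_k < 1`.
 [cite: BalabanImbrieJaffe1988, (5.14.2) p.308, (5.14.3) p.309] -/
theorem contDiffAt_inv_scale (p c : ℝ) {ek : ℝ} (hek : 0 < ek) {s : ℝ} (hs : s ∈ {s : ℝ | 0 < s ∧ s * ek < 1}) :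
    ContDiffAt ℝ ∞ (fun σ => (c * pLog p (σ * ek))⁻¹) s := by
  have h : ContDiffOn ℝ ∞ (fun σ => 1 / (c * pLog p (σ * ek))) {s : ℝ | 0 < s ∧ s * ek < 1} :=
    contDiffOn_infty.2 fun n => BIJ88ChiTDerivN309.contDiffOn_inner p 1 c hek n
  exact (h.contDiffAt ((BIJ88ChiTDerivN309.isOpen_branch ek).mem_nhds hs)).congr_of_eventuallyEq
    (Filter.Eventually.of_forall fun σ => (one_div _).symm)

/-- on the branch the scale `c·p(te_k)` is non-zero for `c ≠ 0`. [cite: BalabanImbrieJaffe1988, (5.14.2) p.308, (5.14.3) p.309] -/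
theorem inv_scale_ne_zero (p : ℝ) {c ek t : ℝ} (hc : c ≠ 0) (hek : 0 < ek) (ht : 0 < t) (h1 : t * ek < 1) :
    (c * pLog p (t * ek))⁻¹ ≠ 0 := by
  have hL : 0 < -Real.log (t * ek) := by have := Real.log_neg (mul_pos ht hek) h1; linarith
  have hP : 0 < pLog p (t * ek) := by
    rw [BIJ88ChiTDeriv309.pLog_eq_rpow_neg_log p (mul_pos ht hek) h1]; exact Real.rpow_pos_of_pos hL p
  exact inv_ne_zero (mul_ne_zero hc hP.ne')

/-- **χ-SLOTS ARE `C_b^∞` IN THE FIELD (linear slot field)**: for a linear `ℓ` on the field space, `c ≠ 0` and `t` on the branch,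
`φ ↦ ∂_t^m χ(c·p(te_k), ℓ(φ))` — the `m`-times t-differentiated χ-factor of p. 308 — is smooth with all derivatives bounded.
[cite: BalabanImbrieJaffe1988, (5.14.2) p.308, (5.14.3) p.309] -/
theorem cbInf_iteratedDeriv_cutoff_linear (p : ℝ) {c ek t : ℝ} (hc : c ≠ 0) (hek : 0 < ek) (ht : 0 < t) (h1 : t * ek < 1)
    {ℓ : (α → ℝ) → ℝ} (hℓ : IsLinearMap ℝ ℓ) (m : ℕ) :
    CbInf fun φ : α → ℝ => iteratedDeriv m (fun s => cutoff χ (c * pLog p (s * ek)) (ℓ φ)) t := by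
  have hg := cbInf_iteratedDeriv_chi1_mul χ (BIJ88ChiTDerivN309.isOpen_branch ek)
    (fun s hs => contDiffAt_inv_scale p c hek hs) m (t := t) ⟨ht, h1⟩ (inv_scale_ne_zero p hc hek ht h1)
  have hcomp := BIJ88SmoothFactors5133.CbInf.comp_clm hg (LinearMap.toContinuousLinearMap (IsLinearMap.mk' ℓ hℓ))
  refine (congrArg CbInf (funext fun φ => ?_)).mp hcomp
  simp only [LinearMap.coe_toContinuousLinearMap', IsLinearMap.mk'_apply, cutoff, div_eq_mul_inv]

/-- the χ-factor is blind to the sign of its argument (χ(1,·) even): `χ(P, |x|) = χ(P, x)`.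
 [cite: BalabanImbrieJaffe1988, (5.14.2) p.308, (5.14.3) p.309] -/
theorem cutoff_abs (P x : ℝ) : cutoff χ P |x| = cutoff χ P x := by
  rcases le_or_gt 0 x with hx | hx
  · rw [abs_of_nonneg hx]
  · rw [abs_of_neg hx, BIJ88Sect5Statements.cutoff_neg]

/-- **χ-slots restricting `|ℓ(φ)|`** (a real linear slot field through its modulus) are `C_b^∞` — by evenness this is the linear case.
[cite: BalabanImbrieJaffe1988, (5.14.2) p.308, (5.14.3) p.309] -/
theorem cbInf_iteratedDeriv_cutoff_abs_linear (p : ℝ) {c ek t : ℝ} (hc : c ≠ 0) (hek : 0 < ek) (ht : 0 < t) (h1 : t * ek < 1)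
    {ℓ : (α → ℝ) → ℝ} (hℓ : IsLinearMap ℝ ℓ) (m : ℕ) :
    CbInf fun φ : α → ℝ => iteratedDeriv m (fun s => cutoff χ (c * pLog p (s * ek)) |ℓ φ|) t := by
  simp_rw [cutoff_abs]
  exact cbInf_iteratedDeriv_cutoff_linear χ p hc hek ht h1 hℓ m

variable {F : Type} [NormedAddCommGroup F] [InnerProductSpace ℝ F] [FiniteDimensional ℝ F] in
/-- **χ-slots restricting the MODULUS `‖L(φ)‖` of a vector-valued linear slot field** (e.g. a complex field component, `F = ℝ²`) are
`C_b^∞`: `φ ↦ ∂_t^m χ(c·p(te_k), ‖L(φ)‖)`, `c ≠ 0`, `t` on the branch. [cite: BalabanImbrieJaffe1988, (5.14.2) p.308, (5.14.3) p.309] -/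
theorem cbInf_iteratedDeriv_cutoff_norm_linear (p : ℝ) {c ek t : ℝ} (hc : c ≠ 0) (hek : 0 < ek) (ht : 0 < t) (h1 : t * ek < 1)
    (L : (α → ℝ) →ₗ[ℝ] F) (m : ℕ) :
    CbInf fun φ : α → ℝ => iteratedDeriv m (fun s => cutoff χ (c * pLog p (s * ek)) ‖L φ‖) t := by
  have hg := cbInf_iteratedDeriv_chi1_norm_mul χ (F := F) (BIJ88ChiTDerivN309.isOpen_branch ek)
    (fun s hs => contDiffAt_inv_scale p c hek hs) m (t := t) ⟨ht, h1⟩ (inv_scale_ne_zero p hc hek ht h1)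
  have hcomp := BIJ88SmoothFactors5133.CbInf.comp_clm hg (LinearMap.toContinuousLinearMap L)
  refine (congrArg CbInf (funext fun φ => ?_)).mp hcomp
  simp only [LinearMap.coe_toContinuousLinearMap', cutoff, div_eq_mul_inv]

variable {E : Type} [NormedAddCommGroup E] [NormedSpace ℝ E] in
/-- **`V(Y)`-SLOTS ARE `C_b^∞`**: for `V ∈ C_b^∞`, `φ ↦ ∂_t^m e^{−tV(φ)} = (−V(φ))^m e^{−tV(φ)}` is in `C_b^∞`.
 [cite: BalabanImbrieJaffe1988, (5.14.2) p.308, (5.14.3) p.309] -/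
theorem cbInf_iteratedDeriv_expWeight {G : E → ℝ} (hG : CbInf G) (t : ℝ) (m : ℕ) :
    CbInf fun φ : E => iteratedDeriv m (fun s => Real.exp (-(s * G φ))) t := by
  have h := (cbInf_pow (cbInf_neg hG) m).mul (cbInf_exp (cbInf_neg (cbInf_const_mul hG t)))
  refine (congrArg CbInf (funext fun φ => ?_)).mp h
  exact (BIJ88RestrictedInteractionAllOrders308.iteratedDeriv_expWeight (G φ) t m).symm

variable {ι υ : Type} (p : ℝ) {ek t : ℝ} (B : Finset ι) {Φ : ι → (α → ℝ) → ℝ} {c : ι → ℝ} (Ys : Finset υ)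
  {V : υ → (α → ℝ) → ℝ}

/-- the χ-slot derivative factor `u_{inl b, m} = ∂_t^m χ(c_b p(te_k), Φ_b(·))` of `BIJ88SlotMomentsGauss308.uD` is in `C_b^∞`.
[cite: BalabanImbrieJaffe1988, (5.14.2) p.308, (5.14.3) p.309] -/
theorem cbInf_uD_inl (hek : 0 < ek) (ht : 0 < t) (h1 : t * ek < 1) (b : ↥B) (hΦ : IsLinearMap ℝ (Φ b)) (hc : c b ≠ 0)
    (m : ℕ) : CbInf (BIJ88SlotMomentsGauss308.uD χ p ek B Φ c Ys V t (Sum.inl b) m) :=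
  cbInf_iteratedDeriv_cutoff_linear χ p hc hek ht h1 hΦ m

/-- the `V(Y)`-slot derivative factor `u_{inr Y, m} = ∂_t^m e^{−tV_Y(·)}` of `BIJ88SlotMomentsGauss308.uD` is in `C_b^∞`.
[cite: BalabanImbrieJaffe1988, (5.14.2) p.308, (5.14.3) p.309] -/
theorem cbInf_uD_inr (Y : ↥Ys) (hV : CbInf (V Y)) (m : ℕ) :
    CbInf (BIJ88SlotMomentsGauss308.uD χ p ek B Φ c Ys V t (Sum.inr Y) m) :=
  cbInf_iteratedDeriv_expWeight hV t m

/-- **THE LOCATED DERIVATIVE OBSERVABLES ARE SMOOTH FACTORS**: every cube's observable `Π_{τ: cube τ = i} ∂_t^{#slots at τ}(factor τ)` of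
p25's `BIJ88Expansion5143Gauss.fD` on the p. 308 slot data `uD` is in the class `C_b^∞` of the §5.13 walk form — linear slot fields,
`c_b ≠ 0`, `V_Y ∈ C_b^∞`, `t` on the branch. [cite: BalabanImbrieJaffe1988, (5.14.2) p.308, (5.14.3) p.309] -/
theorem cbInf_fD_uD [DecidableEq ι] [DecidableEq υ] (hek : 0 < ek) (ht : 0 < t) (h1 : t * ek < 1)
    (hΦ : ∀ b ∈ B, IsLinearMap ℝ (Φ b)) (hc : ∀ b ∈ B, c b ≠ 0) (hV : ∀ Y ∈ Ys, CbInf (V Y)) {I : Type} [DecidableEq I]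
    (cube : ↥B ⊕ ↥Ys → I) {S : Type*} (γ : S → ↥B ⊕ ↥Ys) (K : Finset S) (i : I) :
    CbInf (BIJ88Expansion5143Gauss.fD (BIJ88SlotMomentsGauss308.uD χ p ek B Φ c Ys V t) cube γ K i) := by
  refine BIJ88SmoothFactors5133.CbInf.prod _ fun τ _ => ?_
  rcases τ with ⟨b, hb⟩ | ⟨Y, hY⟩
  · exact cbInf_uD_inl χ p B Ys hek ht h1 ⟨b, hb⟩ (hΦ b hb) (hc b hb) _
  · exact cbInf_uD_inr χ p B Ys ⟨Y, hY⟩ (hV Y hY) _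

end Slots

end Literature.MathematicalPhysics.QuantumFieldTheory.BalabanImbrieJaffe1984to88.BIJ88SlotFactorsSmooth308
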